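import Summits.CriticalPhenomena.PercolationContinuityZ3.Theorems.PercNearOneGluingNoHeavyQuantReflectionGates
import Summits.CriticalPhenomena.PercolationContinuityZ3.Theorems.PercNearOneGluingNoHeavyQuantThreeValuedReduction
import HarnessLib

/-!
# QUANT lane R8, T-DEC: the reflection lemma with gates in the CLOSED interval `[1/2, 1]` — the cells `g ≥ 1/2` of the Hoeffding
# reduction (`m` ones and `r` equal gates `g ≥ 1/2`) are heavy at the average gate (prim-quant-census-2 gen 83, file 4)

builds on p205010 (kernel theorem, internal audit signed; external expert review pending)

Support file (`--supports stmt-CriticalPhenomena-4575`), QUANT lane census seat prim-quant-census-2 (gen 83); memo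
`run/shared/lean/prim/quant/prim-quant-census-2-g83/HOEFFDING-G83.md`.  Theorems only, standard axioms, no sorries, no definitions.

`heavy_blobLaw_gates_of_half_le` (census-2 g82, `…QuantReflectionGates`) asks for gates in `[1/2, 1)`; its proof uses `g < 1` only to get
`ΣG < |G|`.  The three-value reduction `heavy_blobLaw_of_onesEqualFamily` (`…QuantThreeValuedReduction`) produces gate lists `(1^m, g^r)` WITH
gates equal to `1`; when `g ≥ 1/2` every gate of such a list lies in `[1/2, 1]` and `ΣG = m + r·g < m + r` as soon as `r ≥ 1`, `g < 1`.
* **`heavy_blobLaw_gates_of_half_le_closed`** — gates in `[1/2, 1]`, `ΣG < |G|` ⟹ `blobLaw (G.map (k,·))` heavy at floor `ΣG/|G|`, target `k·ΣG`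
  (the reflection certificate `b ↔ n·k − b` with the general-gates capacity `pb_reflection_capacity`, verbatim from g82).
* **`heavy_onesEqual_of_half_le`** — the REFLECTION CELLS of the Hoeffding reduction: for `m` ones and `r ≥ 1` gates `g ∈ [1/2, 1)` the law of
  `(1^m, g^r)` is heavy at floor `(m + r·g)/(m + r)` and target `k·(m + r·g)`; `heavy_onesEqual_of_half_le_floor` — at any floor `x ≤ (m + r·g)/(m+r)`
  (the form consumed by `heavy_blobLaw_of_onesEqualFamily`, floor `ΣG/|G|` with `|G| ≥ m + r`).

HONEST STATUS.  Cells only; conjecture BLOB-AFL in the middle band beyond width 4, conjecture C, `SiblingStep`, `FarTreeRow`, `GluedLemmaW`,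
`GluedDominatedMass` OPEN; RATE class (log\*) / honest sentence of `run/shared/lean/prim/quant/README.md` unchanged.  [this work].  Nothing here
is cited as a published result.  The gluing rows served [cite: KozmaNitzan2024, Conjecture 3 (p. 15)]; product measure [cite: Grimmett1999, §1.3 p. 10].
-/

noncomputable section

open scoped BigOperators

namespace Summit.CriticalPhenomena.PercolationContinuityZ3.Theorems
namespace Quant

open Finset

/-- the two-point law `{lo, hi; g}` (as in `…QuantLawDEC`) -/
local notation3 "TP[" lo ", " hi ", " g ", " h "]" =>
  (g : ℝ) * (if (h : ℕ) = (hi : ℕ) then (1 : ℝ) else 0) + (1 - (g : ℝ)) * (if (h : ℕ) = (lo : ℕ) then (1 : ℝ) else 0)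

/-- a HEAVY decomposition of the law `μ` on `{0..M}` at floor `x`, target `T` (the inline `∃` consumed by `decAtT_of_heavy`) -/
local notation3 "HEAVY[" x ", " T ", " M ", " μ "]" =>
  ∃ (ι : Type) (_ : Fintype ι) (lam γ : ι → ℝ) (lo hi : ι → ℕ),
    (∀ i, 0 ≤ lam i) ∧ (∑ i, lam i = 1) ∧ (∀ i, 0 ≤ γ i ∧ γ i ≤ 1) ∧ (∀ i, lo i ≤ hi i) ∧ (∀ i, hi i ≤ (M : ℕ)) ∧
    (∀ h, (μ : ℕ → ℝ) h = ∑ i, lam i * TP[lo i, hi i, γ i, h]) ∧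
    (∀ i, 0 < lam i → (x : ℝ) ≤ γ i ∧ (T : ℝ) ≤ 2 * (lo i : ℝ) + ((hi i : ℝ) - lo i) * γ i)

/-- the blob list of a gate list at the common blob size `k` -/
local notation3 "BL[" k ", " G "]" => LawDec.blobLaw (List.map (fun g : ℝ => ((k : ℕ), g)) G)

/-- the Poisson-binomial point mass `P_G(j)`: the law of the blobs `(k, g)`, `g ∈ G`, at the atom `j·k` -/
local notation3 "PB[" k ", " G ", " j "]" => LawDec.blobLaw (List.map (fun g : ℝ => ((k : ℕ), g)) G) ((j : ℕ) * (k : ℕ))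

namespace LawDec

/-- **n EQUAL BLOBS WITH ARBITRARY GATES `gᵢ ∈ [1/2, 1]` AND `Σgᵢ < n` ARE HEAVY AT FLOOR `(Σgᵢ)/n`, TARGET `k·Σgᵢ`** — the closed-interval
form of `heavy_blobLaw_gates_of_half_le` (same reflection certificate; `g < 1` was used there only for `Σgᵢ < n`). [this work] -/
theorem heavy_blobLaw_gates_of_half_le_closed (k : ℕ) (G : List ℝ) (hG : ∀ g ∈ G, 1 / 2 ≤ g ∧ g ≤ 1) (hSlt : G.sum < G.length) :
    HEAVY[G.sum / G.length, (k : ℝ) * G.sum, G.length * k, BL[k, G]] := by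
  have hG0 : ∀ g ∈ G, 0 ≤ g ∧ g ≤ 1 := fun g hg => ⟨by linarith [(hG g hg).1], (hG g hg).2⟩
  have htop := blobTop_blobs k G
  have hμ0 := blobLaw_nonneg _ (blobs_gates_mem k G hG0)
  have hμM : ∀ h, G.length * k < h → BL[k, G] h = 0 := fun h hh => blobLaw_eq_zero _ h (by rw [htop]; exact hh)
  have hμ1 : ∑ h ∈ Finset.range (G.length * k + 1), BL[k, G] h = 1 := by
    have h1 := sum_blobLaw (List.map (fun g : ℝ => (k, g)) G); rwa [htop] at h1
  have hnpos : 0 < G.length := by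
    rcases Nat.eq_zero_or_pos G.length with h0 | h
    · exfalso
      rw [List.eq_nil_of_length_eq_zero h0] at hSlt
      simp at hSlt
    · exact h
  have hn : (0 : ℝ) < G.length := by exact_mod_cast hnpos
  have hx0 : 0 ≤ G.sum / G.length := div_nonneg (by linarith [half_length_le_sum G fun g hg => (hG g hg).1]) hn.le
  have hx1 : G.sum / G.length < 1 := (div_lt_one hn).2 hSlt
  refine heavy_of_reflection (G.length * k) _ (G.sum / G.length) ((k : ℝ) * G.sum) hx0 hx1 hμ0 hμM hμ1 ?_ ?_
  · push_cast
    have e : G.sum / (G.length : ℝ) * ((G.length : ℝ) * k) = (k : ℝ) * G.sum := by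
      field_simp
    rw [e]
  · intro b hb
    by_cases hdvd : k ∣ b
    · obtain ⟨j, rfl⟩ := hdvd
      rcases Nat.eq_zero_or_pos k with hk0 | hk
      · subst hk0
        simp only [Nat.cast_zero, zero_mul] at hb
        have : (0 : ℝ) ≤ 2 * ((0 * j : ℕ) : ℝ) := by positivity
        linarith
      have hk' : (0 : ℝ) < k := by exact_mod_cast hk
      have h2j : 2 * (j : ℝ) < G.sum := by
        have e : 2 * ((k * j : ℕ) : ℝ) = (2 * (j : ℝ)) * k := by push_cast; ring
        rw [e] at hb
        have hb' : (2 * (j : ℝ)) * k < G.sum * k := by linarith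
        exact lt_of_mul_lt_mul_right hb' hk'.le
      have hjn : 2 * j + 1 ≤ G.length := by
        have : (2 * j : ℝ) < G.length := by linarith
        exact_mod_cast this
      have hcap := pb_reflection_capacity k hk G hG j hjn
      rw [show k * j = j * k by ring, show G.length * k - j * k = (G.length - j) * k by rw [Nat.sub_mul]]
      refine le_of_mul_le_mul_left ?_ hn
      calc (G.length : ℝ) * (G.sum / G.length * PB[k, G, j]) = G.sum * PB[k, G, j] := by
            field_simp
        _ ≤ ((G.length : ℝ) - G.sum) * PB[k, G, G.length - j] := hcap
        _ = (G.length : ℝ) * ((1 - G.sum / G.length) * PB[k, G, G.length - j]) := by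
            field_simp
    · rw [blobLaw_eq_zero_of_not_dvd k _ (fun p hp => by
          obtain ⟨g, _, rfl⟩ := List.mem_map.1 hp; exact dvd_rfl) b hdvd, mul_zero]
      exact mul_nonneg (by linarith) (hμ0 _)

/-- **THE REFLECTION CELLS OF THE HOEFFDING REDUCTION.**  For `m` ones and `r ≥ 1` gates `g ∈ [1/2, 1)` the law of the gate list `(1^m, g^r)`
(blob size `k`) is heavy at floor `(m + r·g)/(m + r)` and target `k·(m + r·g)` on `{0..(m+r)·k}`. [this work] -/
theorem heavy_onesEqual_of_half_le (k m r : ℕ) {g : ℝ} (hg : 1 / 2 ≤ g) (hg1 : g < 1) (hr : 0 < r) :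
    HEAVY[((m : ℝ) + r * g) / ((m : ℝ) + r), (k : ℝ) * (m + r * g), (m + r) * k, BL[k, List.replicate m 1 ++ List.replicate r g]] := by
  have hS : (List.replicate m (1 : ℝ) ++ List.replicate r g).sum = m + r * g := by
    simp only [List.sum_append, List.sum_replicate, nsmul_eq_mul, mul_one]
  have hL : (List.replicate m (1 : ℝ) ++ List.replicate r g).length = m + r := by simp
  have hG : ∀ x ∈ List.replicate m (1 : ℝ) ++ List.replicate r g, 1 / 2 ≤ x ∧ x ≤ 1 := by
    intro x hx
    rcases List.mem_append.1 hx with h | h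
    · rw [List.eq_of_mem_replicate h]; norm_num
    · rw [List.eq_of_mem_replicate h]; exact ⟨hg, hg1.le⟩
  have hSlt : (List.replicate m (1 : ℝ) ++ List.replicate r g).sum < (List.replicate m (1 : ℝ) ++ List.replicate r g).length := by
    rw [hS, hL]; push_cast
    have hr' : (0 : ℝ) < r := by exact_mod_cast hr
    nlinarith
  have key := heavy_blobLaw_gates_of_half_le_closed k _ hG hSlt
  rw [hS, hL] at key
  push_cast at key
  exact key

/-- the reflection cells at any floor `x ≤ (m + r·g)/(m + r)` (e.g. `x = ΣG/|G|` with `|G| ≥ m + r`). [this work] -/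
theorem heavy_onesEqual_of_half_le_floor (k m r : ℕ) {g x : ℝ} (hg : 1 / 2 ≤ g) (hg1 : g < 1) (hr : 0 < r)
    (hx : x ≤ ((m : ℝ) + r * g) / ((m : ℝ) + r)) :
    HEAVY[x, (k : ℝ) * (m + r * g), (m + r) * k, BL[k, List.replicate m 1 ++ List.replicate r g]] :=
  heavy_mono _ _ _ _ _ _ hx le_rfl (heavy_onesEqual_of_half_le k m r hg hg1 hr)

end LawDec
end Quant
end Summit.CriticalPhenomena.PercolationContinuityZ3.Theorems
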